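import Summits.HodgeConjecture.HodgeConjecture.Theorems.AnchorTransportVariationalHodgePadicUncountablePropagation
import Literature.AlgebraicGeometry.HodgeTheory.SupportPropagationDominantCurve
import Literature.AlgebraicGeometry.HodgeTheory.MotivatedClassesDeformation
import Literature.AlgebraicGeometry.Motives.CurveThroughTwoPointsNonSeparated

/-!
# Route AnchorTransport — crux `VariationalHodge` (stmt-HodgeConjecture-1076), line `padic-disc-transport`:
# EVERYWHERE PROPAGATION through a Mumford curve (I: algebraically closed field of definition)

HONEST FRAMING: research route conditional on HC_CM; not a corollary; Q11.4-sentence-2 already refuted in dim ≥ 3.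
Helper file on the crux item (nothing here closes it; no definition, no named fact, no `sorry`;
`HC_CM` does not occur). Cell `pub-hodge-ring2`, binder seat `ring2-b03` (gen 34), BINDER-OWNERS row b03.

Sequel of `AnchorTransportVariationalHodgePadicUncountablePropagation.lean` (gen 32: uncountable
propagation, then STUB G for QUASI-PROJECTIVE total spaces through the algebraicity-locus structure
theorem and the projective dimension theorem on slices, both of which use an embedding `𝒳 ↪ ℙᴺ`).
This file and its sequel `AnchorTransportVariationalHodgePadicGenericPropagationProper.lean` remove
the binder `IsQuasiProjectiveOver (𝒳₀ ⊗_σ ℂ)` from STUB G.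

The road (Voisin, *Hodge Theory II*, §3.3.1; Charles–Schnell 2014, proof of Prop. 11.3.11, for a
smooth PROPER family with projective fibres over a smooth affine curve `S = S₀ ⊗_σ ℂ`):

1. (`everywherePropagation_of_isAlgClosed`, `k` algebraically closed; steps 1–2 verbatim from gen 32.)
   `A|_{𝒳_s}` dies off a closed `V ⊆ 𝒳_s` of codimension `≥ p`; spread `V` to a closed
   `Z ⊆ 𝒲₀ = 𝒳₀ ×_{S₀} T₀` over a smooth affine integral `T₀` dominating `S₀`, with a complex point
   `t` of `T = T₀ ⊗ ℂ` over the generic point of `T₀`, `h(t) = s`, `𝒲_t ≅ 𝒳_s` carrying the slice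
   `Z_t` to `V` (`exists_spread_isClosed_fiberOver_generic_smooth`); death of `q^*A` off `Z` is
   constant over the complex points of `T` above a `k`-rational open `O₀ ∋ η_{T₀}`
   (`map_fiberι_mem_ker_restrictCompl_iff_of_baseChangeHom'`), so it holds over all of
   `O = pr⁻¹ O₀ ∋ t`; the slice over `t` has codimension `≥ p` (transport from `V`).
2. (`mem_algebraicClasses_of_good_open`, the new step — NO openness of the codimension condition and
   NO countable-union structure of the algebraicity locus is used.) `h : T → S` is dominant, so the
   images of the complex points of `T` are uncountable
   (`ComplexPoints.not_countable_image_of_isDominant_of_smoothCurve`); pick `t'` with `h t' ≠ h t`.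
   MUMFORD'S CURVE LEMMA (the tree's unconditional
   `mumford_smoothCurve_through_two_points_of_irreducibleSpace_of_smooth`) gives a smooth irreducible
   affine curve `γ : C → T` through `t` and `t'`; `φ = γ ≫ h : C → S` hits two distinct closed points,
   hence is DOMINANT (`isDominant_of_apply_eq_of_apply_ne`). Pull the family and the supports back to
   `C` (`familyPullback`, pasting of cartesian squares, `fiberOverFamilyPullbackIso`): death holds
   over the non-empty open `γ⁻¹ O ∋ a'` (`γ a' = t`) and the slice over `a'` has codimension `≥ p`.
   The tree's `mem_algebraicClasses_of_dominant_curve` (`SupportPropagationDominantCurve`: the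
   dominating pieces of the image of the supports in `𝒳 × C` are flat over `C` of the right
   dimension; push to `𝒳 × S`, close up, and apply upper semicontinuity of supports + SGA1 XII 2.2
   over the curve `S` itself) gives algebraicity of `A|_{𝒳_u}` at EVERY complex point `u` of `S`.

References: [VoisinHodgeII2003] §3.3.1; [CharlesSchnell2014Notes] Prop. 11.3.11 (proof),
Lemma 11.3.14; [MumfordAV1970] §6 Lemma.
-/

noncomputable section

-- every declaration of this problem lives in `Summit.HodgeConjecture.HodgeConjecture.…` (summit = sub-problem)
set_option linter.dupNamespace false

open CategoryTheory CategoryTheory.Limits AlgebraicGeometry TopologicalSpace Order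
open Literature.AlgebraicGeometry.Motives Literature.AlgebraicGeometry.HodgeTheory

namespace Summit.HodgeConjecture.HodgeConjecture.Theorems

/-! ### A curve through the spread point: from one good open of the parameter variety to every fibre -/

section Curve

variable {𝒳 S T 𝒲 : SchemeOver ℂ} (f : 𝒳 ⟶ S) (h : T ⟶ S) (q : 𝒲 ⟶ 𝒳) (g : 𝒲 ⟶ T)

/-- **From death over a good open of a dominating parameter variety to EVERY fibre, through a
Mumford curve.** Let `f : 𝒳 ⟶ S` be a smooth projective family of relative dimension `n` over a
smooth integral AFFINE curve `S` (total space only proper over `S`), `(q, g; f, h)` a cartesian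
square with `T` smooth, irreducible and separated over `ℂ` and `h` dominant, `Z ⊆ 𝒲` closed,
`A ∈ H²ᵖ(𝒳(ℂ); ℂ)`, `O ⊆ T` open such that `(q^* A)|_{𝒲_y}` dies off the slice `ι_y⁻¹ Z` for every
complex point `y` of `O`, and `t ∈ O` a complex point whose slice has codimension `≥ p`
(`height + p ≤ n`). Then `A|_{𝒳_u}` is algebraic at every complex point `u` of `S`: a second
complex point `t'` with `h t' ≠ h t` exists (the image of `T(ℂ)` is uncountable), Mumford's lemma
gives a smooth affine curve `γ : C → T` through `t, t'`, `γ ≫ h` is dominant, and the tree's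
`mem_algebraicClasses_of_dominant_curve` applies to the family and supports pulled back to `C`.
[cite: MumfordAV1970, §6, Lemma] [cite: VoisinHodgeII2003, §3.3.1]
[cite: CharlesSchnell2014Notes, Prop. 11.3.11 (proof)] -/
theorem mem_algebraicClasses_of_good_open {n : ℕ} (hf : IsSmoothProjectiveFamily f n)
    [IsAffine S.left] [IsIntegral S.left] [SmoothOfRelativeDimension 1 S.hom]
    [IrreducibleSpace T.left] [AlgebraicGeometry.Smooth T.hom] [IsSeparated T.hom]
    [IsDominant h.left] (H : IsPullback q g f h) (p : ℕ) (A : complexBetti 𝒳 (2 * p))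
    {Z : Set 𝒲.left} (hZ : IsClosed Z) {O : Set T.left} (hO : IsOpen O)
    (hdeath : ∀ y : ComplexPoints T, y.pt ∈ O →
      complexBetti.restrictCompl (fiberOver g y) ((fiberι g y).left.base ⁻¹' Z) (2 * p)
        (complexBetti.map (fiberι g y) (2 * p) (complexBetti.map q (2 * p) A)) = 0)
    (t : ComplexPoints T) (ht : t.pt ∈ O)
    (hcodim : ∀ z : (fiberOver g t).left, (fiberι g t).left.base z ∈ Z → height z + p ≤ (n : ℕ∞))
    (u : ComplexPoints S) :
    complexBetti.map (fiberι f u) (2 * p) A ∈ algebraicClasses (fiberOver f u) p := by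
  classical
  haveI : AlgebraicGeometry.Smooth S.hom := SmoothOfRelativeDimension.smooth 1 S.hom
  haveI : LocallyOfFiniteType S.hom := inferInstance
  haveI : LocallyOfFiniteType T.hom := inferInstance
  -- ### a second complex point of `T` with a different image in `S`
  obtain ⟨t', ht'⟩ : ∃ t' : ComplexPoints T, AlgPoints.map h t' ≠ AlgPoints.map h t := by
    by_contra hall
    refine ComplexPoints.not_countable_image_of_isDominant_of_smoothCurve h ⊤ ⟨t, trivial⟩ ?_
    refine (Set.countable_singleton (AlgPoints.map h t)).mono ?_
    rintro _ ⟨x, -, rfl⟩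
    exact Set.mem_singleton_iff.2 (not_not.1 fun hx => hall ⟨x, hx⟩)
  -- ### Mumford's smooth affine curve through `t` and `t'`
  obtain ⟨C, γ, a', b', hCaff, hCirr, hCsm, hCdim, ha', hb'⟩ :=
    mumford_smoothCurve_through_two_points_of_irreducibleSpace_of_smooth (S := T) t t'
  subst ha' hb'
  haveI := hCaff
  haveI := hCirr
  haveI := hCsm
  haveI : IsIntegral C.left := isIntegral_of_irreducibleSpace_of_smooth C
  haveI : SmoothOfRelativeDimension 1 C.hom :=
    Ring2.Hypotheses.smoothOfRelativeDimension_one_of_topologicalKrullDim C hCdim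
  -- `γ ≫ h : C ⟶ S` is dominant: its image contains two distinct closed points
  haveI : IsDominant (γ ≫ h).left := by
    refine isDominant_of_apply_eq_of_apply_ne (T := S) (γ ≫ h).left a'.pt b'.pt
      (a := (AlgPoints.map (γ ≫ h) a').pt) rfl fun hpt => ht' ?_
    rw [← AlgPoints.map_comp_apply, ← AlgPoints.map_comp_apply]
    exact pt_injective S (a₁ := AlgPoints.map (γ ≫ h) b') (a₂ := AlgPoints.map (γ ≫ h) a') hpt
  -- ### the family and the supports pulled back to `C`
  let gC : familyPullback g γ ⟶ C := familyPullback.snd g γ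
  let qW : familyPullback g γ ⟶ 𝒲 := familyPullback.fst g γ
  have HC : IsPullback (qW ≫ q) gC f (γ ≫ h) := (familyPullback.isPullback g γ).paste_horiz H
  have hZC : IsClosed (qW.left.base ⁻¹' Z) := hZ.preimage qW.left.continuous
  -- fibres of the pulled-back family: `(𝒲 ×_T C)_c ≅ 𝒲_{γ c}`, compatibly with the slices
  have hfib : ∀ c : ComplexPoints C,
      (fiberι gC c).left.base ⁻¹' (qW.left.base ⁻¹' Z) =
        (fiberOverFamilyPullbackIso g γ c).hom.left.base ⁻¹'
          ((fiberι g (AlgPoints.map γ c)).left.base ⁻¹' Z) := fun c => by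
    ext z
    have hc := congrArg (fun ψ => ψ.left.base z) (fiberOverFamilyPullbackIso_hom_fiberι g γ c)
    simp only [Over.comp_left, Scheme.Hom.comp_base, TopCat.coe_comp, Function.comp_apply] at hc
    simp only [Set.mem_preimage]
    rw [hc]
  -- death over the open `γ⁻¹ O ∋ a'`
  have hUo : IsOpen (γ.left.base ⁻¹' O) := hO.preimage γ.left.continuous
  have haU : a'.pt ∈ γ.left.base ⁻¹' O := ht
  have hdeathC : ∀ c : ComplexPoints C, c.pt ∈ γ.left.base ⁻¹' O →
      complexBetti.restrictCompl (fiberOver gC c) ((fiberι gC c).left.base ⁻¹' (qW.left.base ⁻¹' Z))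
        (2 * p) (complexBetti.map (fiberι gC c) (2 * p)
          (complexBetti.map (qW ≫ q) (2 * p) A)) = 0 := by
    intro c hc
    have hy := hdeath (AlgPoints.map γ c) hc
    have hqq : complexBetti.map (qW ≫ q) (2 * p) A =
        complexBetti.map qW (2 * p) (complexBetti.map q (2 * p) A) := by
      rw [complexBetti.map_comp]; rfl
    rw [hqq, map_fiberι_map_eq_map_of_fiberIso g qW gC (fiberOverFamilyPullbackIso g γ c)
      (fiberOverFamilyPullbackIso_hom_fiberι g γ c) (2 * p), hfib c]
    exact complexBetti.restrictCompl_map_eq_zero _ hy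
  -- codimension of the slice over `a'`
  have haC : ∀ z : (fiberOver gC a').left,
      (fiberι gC a').left.base z ∈ qW.left.base ⁻¹' Z → height z + p ≤ (n : ℕ∞) := by
    intro z hz
    haveI : IsIso (fiberOverFamilyPullbackIso g γ a').hom.left :=
      (inferInstance : IsIso ((Over.forget _).mapIso (fiberOverFamilyPullbackIso g γ a')).hom)
    have hz' : z ∈ (fiberOverFamilyPullbackIso g γ a').hom.left.base ⁻¹'
        ((fiberι g (AlgPoints.map γ a')).left.base ⁻¹' Z) := by
      rw [← hfib a']; exact hz
    rw [← height_base_eq_of_isClosedImmersion' (fiberOverFamilyPullbackIso g γ a').hom.left z]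
    exact hcodim _ hz'
  -- ### the curve theorem over `S`
  exact mem_algebraicClasses_of_dominant_curve f (γ ≫ h) (qW ≫ q) gC hf
    (IsQuasiProjectiveOver.of_isAffine S) HC p A hZC hUo ⟨a'.pt, haU⟩ hdeathC a' haC u

end Curve

/-! ### Everywhere propagation, `k` algebraically closed -/

section AlgClosed

/-- **Propagation from a fibre over the generic point to EVERY fibre, for an algebraically closed
countable field of definition — no quasi-projectivity of the total space.** Let `k` be a
countable algebraically closed field, `σ : k →+* ℂ`, `f₀ : 𝒳₀ ⟶ S₀` over `k` whose
complexification `f : 𝒳 ⟶ S` is a smooth projective family of relative dimension `n` (smooth,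
PROPER, projective fibres) over a smooth irreducible affine curve, `A ∈ H²ᵖ(𝒳(ℂ); ℂ)` and
`s ∈ S(ℂ)` over the generic point of `S₀` with `A|_{𝒳_s}` algebraic. Then `A|_{𝒳_u}` is algebraic
at every complex point `u` (spread of the support, death constancy over a `k`-rational open,
codimension at the spread point, then `mem_algebraicClasses_of_good_open`; module docstring steps
1–2). [cite: VoisinHodgeII2003, §3.3.1] [cite: CharlesSchnell2014Notes, Prop. 11.3.11 (proof) and Lemma 11.3.14]
[cite: MumfordAV1970, §6, Lemma] -/
theorem everywherePropagation_of_isAlgClosed (k : Type) [Field k] [Countable k] [IsAlgClosed k]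
    (σ : k →+* ℂ) ⦃n : ℕ⦄ ⦃𝒳₀ S₀ : SchemeOver k⦄ (f₀ : 𝒳₀ ⟶ S₀)
    (hf : IsSmoothProjectiveFamily ((baseChangeHom σ).map f₀) n)
    (hirr : IrreducibleSpace ((baseChangeHom σ).obj S₀).left)
    (haff : IsAffine ((baseChangeHom σ).obj S₀).left)
    (hsm : AlgebraicGeometry.Smooth ((baseChangeHom σ).obj S₀).hom)
    (hdim : topologicalKrullDim ((baseChangeHom σ).obj S₀).left = 1)
    (p : ℕ) (A : complexBetti ((baseChangeHom σ).obj 𝒳₀) (2 * p))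
    (s : ComplexPoints ((baseChangeHom σ).obj S₀))
    (hs : closure {(baseChangeHomFst σ S₀).base s.pt} = (Set.univ : Set S₀.left))
    (hA : complexBetti.map (fiberι ((baseChangeHom σ).map f₀) s) (2 * p) A ∈
      algebraicClasses (fiberOver ((baseChangeHom σ).map f₀) s) p)
    (u : ComplexPoints ((baseChangeHom σ).obj S₀)) :
    complexBetti.map (fiberι ((baseChangeHom σ).map f₀) u) (2 * p) A ∈
      algebraicClasses (fiberOver ((baseChangeHom σ).map f₀) u) p := by
  classical
  letI := σ.toAlgebra
  haveI := hirr
  haveI := haff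
  haveI := hsm
  haveI : CharZero k := σ.charZero
  -- ### notation and standing instances
  let 𝒳 : SchemeOver ℂ := (baseChangeHom σ).obj 𝒳₀
  let S : SchemeOver ℂ := (baseChangeHom σ).obj S₀
  let f : 𝒳 ⟶ S := (baseChangeHom σ).map f₀
  let prS : S.left ⟶ S₀.left := baseChangeHomFst σ S₀
  haveI : LocallyOfFiniteType S₀.hom := locallyOfFiniteType_of_smooth_baseChangeHom σ S₀
  haveI : IrreducibleSpace S₀.left := irreducibleSpace_of_baseChangeHom σ S₀
  haveI : IsIntegral S.left := isIntegral_of_irreducibleSpace_of_smooth S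
  haveI : IsIntegral S₀.left := isIntegral_of_baseChangeHom σ S₀
  haveI : SmoothOfRelativeDimension 1 S.hom :=
    Ring2.Hypotheses.smoothOfRelativeDimension_one_of_topologicalKrullDim S hdim
  haveI : IsAffineHom S.hom := isAffineHom_of_isAffine S.hom
  haveI : IsSeparated S.hom := inferInstance
  haveI : IsProper f.left := hf.isProper
  haveI : AlgebraicGeometry.Smooth f.left := hf.smooth
  haveI : IsProper f₀.left := isProper_of_baseChangeHom_map σ f₀
  haveI : AlgebraicGeometry.Smooth f₀.left := smooth_of_baseChangeHom_map σ f₀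
  haveI : Surjective prS := (surjective_flat_quasiCompact_baseChangeHomFst σ S₀).1.1
  -- `s` lies over the generic point
  have hs' : prS s.pt = genericPoint S₀.left := base_pt_eq_genericPoint_of_closure_eq σ S₀ s hs
  -- ### step 1: the support of `A|_{𝒳_s}` and its spread
  obtain ⟨V, hVc, hVp, hV0⟩ := mem_supportedClasses_iff_exists.1 hA
  have hfs : IsSmoothProjective n (fiberOver f s) := hf.isSmoothProjective s
  haveI := IsSmoothProjective.isLocallyNoetherian_holds hfs
  haveI := IsSmoothProjective.compactSpace_holds hfs
  haveI : IsNoetherian (fiberOver f s).left := {}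
  have hVcpt : IsCompact Vᶜ := NoetherianSpace.isCompact _
  obtain ⟨T₀, 𝒲₀, hT₀aff, hT₀int, hT₀sm, h₀, hlft, hdom, g₀, q₀, Z, t, e, Hsq, hZ, hts, hgen,
    hcomp, hslice⟩ := exists_spread_isClosed_fiberOver_generic_smooth σ f₀ s hs' hVc hVcpt
  haveI := hT₀aff
  haveI := hT₀int
  haveI := hlft
  haveI := hdom
  haveI : AlgebraicGeometry.Smooth T₀.hom := hT₀sm
  -- ### instances for the parameter scheme and the spread family
  let T : SchemeOver ℂ := (baseChangeHom σ).obj T₀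
  let 𝒲 : SchemeOver ℂ := (baseChangeHom σ).obj 𝒲₀
  let g : 𝒲 ⟶ T := (baseChangeHom σ).map g₀
  let q : 𝒲 ⟶ 𝒳 := (baseChangeHom σ).map q₀
  let h : T ⟶ S := (baseChangeHom σ).map h₀
  let prT : T.left ⟶ T₀.left := baseChangeHomFst σ T₀
  let prW : 𝒲.left ⟶ 𝒲₀.left := baseChangeHomFst σ 𝒲₀
  haveI : IrreducibleSpace T.left := irreducibleSpace_baseChangeHom_left σ (X := T₀)
  haveI : AlgebraicGeometry.Smooth T.hom := smooth_baseChangeHom_hom σ (X := T₀)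
  obtain ⟨d, hd⟩ := exists_smoothOfRelativeDimension_of_smooth (f := T₀.hom)
  haveI := hd
  haveI : LocallyOfFiniteType T₀.hom := by rw [← Over.w h₀]; infer_instance
  haveI : IsAffineHom T₀.hom := isAffineHom_of_isAffine T₀.hom
  haveI : IsSeparated T₀.hom := inferInstance
  haveI : CompactSpace T₀.left := QuasiCompact.compactSpace_of_compactSpace T₀.hom
  haveI : IsProper g₀.left := MorphismProperty.of_isPullback (P := @IsProper) Hsq inferInstance
  haveI : AlgebraicGeometry.Smooth g₀.left :=
    MorphismProperty.of_isPullback (P := @AlgebraicGeometry.Smooth) Hsq inferInstance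
  haveI : LocallyOfFiniteType T.hom := by
    change LocallyOfFiniteType (pullback.snd T₀.hom (Spec.map (CommRingCat.ofHom σ)))
    infer_instance
  haveI : IsSeparated T.hom := by
    change IsSeparated (pullback.snd T₀.hom (Spec.map (CommRingCat.ofHom σ)))
    infer_instance
  have HsqC : IsPullback q g f h := isPullback_baseChangeHom_map_of_isPullback' σ Hsq
  -- ### step 2: death constancy over a `k`-rational open; death and codimension at `t`
  let A' : complexBetti 𝒲 (2 * p) := complexBetti.map q (2 * p) A
  obtain ⟨O₀, hηO₀, hconst⟩ :=
    map_fiberι_mem_ker_restrictCompl_iff_of_baseChangeHom' σ g₀ (d := d) Z hZ (2 * p) A'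
  let Zc : Set 𝒲.left := (prW : 𝒲.left → 𝒲₀.left) ⁻¹' Z
  have hZc : IsClosed Zc := hZ.preimage prW.continuous
  have hslice' : e.hom.left.base ⁻¹' V = (fiberι g t).left.base ⁻¹' Zc := by
    change ⇑e.hom.left ⁻¹' V = ⇑(fiberι g t).left ⁻¹' (⇑prW ⁻¹' Z)
    rw [hslice, Scheme.Hom.comp_base, TopCat.coe_comp, Set.preimage_comp]
  have htO₀ : prT t.pt ∈ O₀ := by
    change baseChangeHomFst σ T₀ t.pt ∈ O₀
    rw [hgen]; exact hηO₀
  have hdeath_t : complexBetti.restrictCompl (fiberOver g t) ((fiberι g t).left.base ⁻¹' Zc) (2 * p)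
      (complexBetti.map (fiberι g t) (2 * p) A') = 0 :=
    restrictCompl_map_fiberι_map_eq_zero_of_fiberIso f q g e hcomp hslice' A hV0
  have hdeathT : ∀ y : ComplexPoints T, y.pt ∈ prT.base ⁻¹' (O₀ : Set T₀.left) →
      complexBetti.restrictCompl (fiberOver g y) ((fiberι g y).left.base ⁻¹' Zc) (2 * p)
        (complexBetti.map (fiberι g y) (2 * p) (complexBetti.map q (2 * p) A)) = 0 :=
    fun y hyO => LinearMap.mem_ker.1 ((hconst t y htO₀ hyO).1 (LinearMap.mem_ker.2 hdeath_t))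
  have hcodim_t : ∀ z : (fiberOver g t).left, (fiberι g t).left.base z ∈ Zc →
      height z + p ≤ (n : ℕ∞) :=
    fun z hz => forall_height_add_le_of_fiberIso f g hfs e hslice' hVp z hz
  -- ### step 3: `h` is dominant; conclude through a Mumford curve
  haveI : IsDominant h.left := by
    have Hh : IsPullback prT h.left h₀.left prS := (isPullback_baseChange_map_left ℂ h₀).flip
    have hT₀ : h₀.left (genericPoint T₀.left) = genericPoint S₀.left :=
      genericPoint_eq_of_isDominant' h₀.left
    have hS : prS (genericPoint S.left) = genericPoint S₀.left := genericPoint_eq_of_isDominant' prS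
    obtain ⟨z, -, hz⟩ := Scheme.Pullback.exists_preimage_pullback (f := h₀.left) (g := prS)
      (genericPoint T₀.left) (genericPoint S.left) (by rw [hT₀, hS])
    refine isDominant_of_apply_eq_genericPoint h.left (v := Hh.isoPullback.inv z) ?_
    rw [← Scheme.Hom.comp_apply, IsPullback.isoPullback_inv_snd]
    exact hz
  exact mem_algebraicClasses_of_good_open f h q g hf HsqC p A hZc
    (O₀.2.preimage prT.continuous) hdeathT t htO₀ hcodim_t u

end AlgClosed

end Summit.HodgeConjecture.HodgeConjecture.Theorems

end
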